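import Summits.CriticalPhenomena.SAWScalingLimit.Theorems.SAWDevelopingMapObservableToSLEHalfPlaneArchTightnessBoundedSpan
import Summits.CriticalPhenomena.SAWScalingLimit.Theorems.SAWDevelopingMapObservableToSLEShortChordLocalityArchMass
import HarnessLib

/-!
# Crux `HexConjecture` (stmt-CriticalPhenomena-0808), line `root-locality-replaces-loewner`:
the ENDPOINT-SUMMED half-plane arch tightness — the half of `stub_halfPlaneArchTightness` that is a theorem

Landing target:
`Summits/CriticalPhenomena/SAWScalingLimit/Theorems/SAWDevelopingMapHexConjectureArchTailSummed.lean`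
(`--supports stmt-CriticalPhenomena-0808`; lead continuation prover-line-stmt-CriticalPhenomena-0808-c3-0).

The registered open stub `stub_halfPlaneArchTightness` (verbatim also on crux stmt-CriticalPhenomena-10472)
asks for ONE `K` such that for ALL spans `n` and every floor endpoint `t` at distance `≤ n` from the
vertical floor mid-edge `s`, the `x_c`-mass of the arches `s → t` of a finite domain `Λ` above the floor
line that reach distance `≥ K n` is at most `ε · Z_{B(2Kn)}(s, t)` — a RELATIVE, POINTWISE-in-`t` tail
bound, uniform in the span (open: "RSW for the critical self-avoiding walk").  This file proves the
ABSOLUTE, ENDPOINT-SUMMED tail bound, uniformly in the domain and in the position of the root: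

* `farArchMass_offsetSum_le` (registered as `stub_archTailSummed`): for every `ε > 0` there is ONE
  threshold `R₀` such that for every cell `x`, every finite `Λ` in the rows `≥ x₁` (strictly above the
  floor line through the midpoint of `s_x = {(x - e₁, 1), (x, 0)}`), every finite set `S` of non-zero
  offsets and every `R ≥ R₀`:
  `Σ_{d ∈ S} FarMass^R_Λ(s_x → t_{x + d e₀}) ≤ ε`,
  where `FarMass^R` sums `x_c^{ℓ(γ)}` over the walks with a vertex at distance `≥ R` from `mid s_x`
  and `t_y = {(y - e₁, 1), (y, 0)}` are the floor mid-edges at the level of `s_x`.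

Proof: the Duminil-Copin–Smirnov arch series.  The total critical floor-arch mass of the half-strip
`S_x(N)` (`archTotal N`, a sum of the coded strip sums of `…HalfPlaneArchTightnessStrips.lean`, hence
independent of `x`) increases in `N` and is bounded by `1/cos(3π/8)` (`sum_floorArchMass_le`,
`…ShortChordLocalityArchMass.lean`), so it is Cauchy: `archTotal N - archTotal N₁ ≤ ε` for
`N ≥ N₁(ε)`.  Every finite `Λ` above the floor lies in some `S_x(N)` (exact restriction,
`farArchMass_mono`), and inside `S_x(N)` a walk reaching distance `≥ 4N₁ + 5` is not a walk of
`S_x(N₁)` (`halfStrip_geometry`), so the summed far mass is at most `archTotal N - archTotal N₁`.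
Sources: DuminilCopinSmirnov2012 (Lemma 2, §3: `A_{T,L} ≤ 1/c_α`), LawlerSchrammWerner2004SAW §3.4
(restriction).  What this does NOT give (and what the line's bootstrap `…RestrictionCocycle.lean`
consumes): smallness of the far mass RELATIVE to `Z(s, t)` for a single endpoint `t` at span
`n → ∞` — see `Cruxes/HexConjecture/Lines/root_locality_replaces_loewner_frontier.md` §3.
-/

noncomputable section

open scoped BigOperators Topology Classical
open Filter Set
open Literature.Probability.LatticeModels (HexVertex hexGraph hexCenter Site)
open Literature.Probability.RandomPlanarGeometry
open Literature.Probability.RandomPlanarGeometry.SAW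
open Literature.Probability.RandomPlanarGeometry.SAW.HV
open Summit.CriticalPhenomena.SAWScalingLimit.Theorems.ObservableToSLE.FloorRatio

namespace Summit.CriticalPhenomena.SAWScalingLimit.Theorems.HexConjecture.RootLocality

/-! ### Offsets along the floor row -/

/-- The cell at offset `d` along the floor row of `x` has the same row index. [folklore] -/
theorem offsetCell_apply_one (x : Site 2) (d : ℤ) : (x + Pi.single 0 d : Site 2) 1 = x 1 := by
  simp

/-- The cell at offset `d` along the floor row of `x` has abscissa `x₀ + d`. [folklore] -/
theorem offsetCell_sub (x : Site 2) (d : ℤ) : (x + Pi.single 0 d : Site 2) 0 - x 0 = d := by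
  simp

/-- A non-zero offset moves the cell. [folklore] -/
theorem offsetCell_ne (x : Site 2) {d : ℤ} (hd : d ≠ 0) : (x + Pi.single 0 d : Site 2) ≠ x := by
  intro h
  have := congrFun h 0
  simp at this
  exact hd this

/-- The offset map is injective. [folklore] -/
theorem offsetCell_injective (x : Site 2) :
    Function.Injective fun d : ℤ => (x + Pi.single 0 d : Site 2) := by
  intro d d' h
  have := congrFun h 0
  simpa using this

/-! ### The coded total arch mass of the strips and its identification at every root cell -/

/-- **The half-strip arch mass at offset `d` is the coded strip sum** (translation invariance,
`archMass_halfStrip_eq`): for `|d| ≤ N + 1` the critical mass of the arches `s_x → t_{x + d e₀}`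
inside `S_x(N)` is the sum of `x_c^ℓ` over the coded mid-edge walks of `S_{N+1,N+1}` ending on the
floor mid-edge at abscissa `d`; in particular it does not depend on `x`.
[cite: DuminilCopinSmirnov2012, §3 (S_{T,L})] -/
theorem archMass_halfStrip_offset (x : Site 2) (N : ℕ) (d : ℤ) (hd : |d| ≤ N + 1) :
    ∑ γ : HexMidEdgeSAW ((stripV (N + 1) (N + 1)).map
        (hvIso.trans (shift (-(x 0)) (-(x 1)))).symm.toEquiv.toEmbedding)
        s((x - Pi.single 1 1, 1), (x, 0))
        s((x + Pi.single 0 d - Pi.single 1 1, 1), (x + Pi.single 0 d, 0)),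
        hexCriticalFugacity ^ γ.length =
      ∑ P ∈ (midWalks (stripV (N + 1) (N + 1))).filter
          (fun P => finalDart P = ((d, 0, false), (d, -1, true)) ∨
            finalDart P = ((d, -1, true), (d, 0, false))),
        hexCriticalFugacity ^ mwLen P := by
  have hy1 : (x + Pi.single 0 d : Site 2) 1 = x 1 := offsetCell_apply_one x d
  have hd' : (x + Pi.single 0 d : Site 2) 0 - x 0 = d := offsetCell_sub x d
  set y : Site 2 := x + Pi.single 0 d with hydef
  clear_value y
  subst hd'
  exact archMass_halfStrip_eq x y N hy1 (floorUp_mem_halfStrip hy1 hd)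

/-- The coded strip sums are nonnegative. [cite: DuminilCopinSmirnov2012, §1] -/
theorem codedArchSum_nonneg (d : ℤ) (N : ℕ) :
    0 ≤ ∑ P ∈ (midWalks (stripV (N + 1) (N + 1))).filter
          (fun P => finalDart P = ((d, 0, false), (d, -1, true)) ∨
            finalDart P = ((d, -1, true), (d, 0, false))),
        hexCriticalFugacity ^ mwLen P :=
  Finset.sum_nonneg fun _ _ => pow_nonneg hexCriticalFugacity_pos_lt_one.1.le _

/-- The offset window `D_N = [-(N+1), N+1] ∖ {0}` increases with `N`. [folklore] -/
theorem offsetWindow_mono {N R : ℕ} (h : N ≤ R) :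
    (Finset.Icc (-((N : ℤ) + 1)) ((N : ℤ) + 1)).erase 0 ⊆
      (Finset.Icc (-((R : ℤ) + 1)) ((R : ℤ) + 1)).erase 0 := by
  intro d hd
  rw [Finset.mem_erase, Finset.mem_Icc] at hd ⊢
  exact ⟨hd.1, by omega, by omega⟩

/-- Membership in the offset window. [folklore] -/
theorem mem_offsetWindow_iff {N : ℕ} {d : ℤ} :
    d ∈ (Finset.Icc (-((N : ℤ) + 1)) ((N : ℤ) + 1)).erase 0 ↔ d ≠ 0 ∧ |d| ≤ N + 1 := by
  rw [Finset.mem_erase, Finset.mem_Icc, abs_le]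

/-- **The total critical floor-arch mass of the strip `S_{N+1,N+1}` increases with `N`** (more
walks and more floor exits). [cite: DuminilCopinSmirnov2012, §3 ("A_T increases in T")] -/
theorem archTotal_mono :
    Monotone fun N : ℕ => ∑ d ∈ (Finset.Icc (-((N : ℤ) + 1)) ((N : ℤ) + 1)).erase 0,
      ∑ P ∈ (midWalks (stripV (N + 1) (N + 1))).filter
          (fun P => finalDart P = ((d, 0, false), (d, -1, true)) ∨
            finalDart P = ((d, -1, true), (d, 0, false))),
        hexCriticalFugacity ^ mwLen P := by
  intro N R h
  dsimp only
  calc _ ≤ ∑ d ∈ (Finset.Icc (-((N : ℤ) + 1)) ((N : ℤ) + 1)).erase 0,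
        ∑ P ∈ (midWalks (stripV (R + 1) (R + 1))).filter
          (fun P => finalDart P = ((d, 0, false), (d, -1, true)) ∨
            finalDart P = ((d, -1, true), (d, 0, false))),
          hexCriticalFugacity ^ mwLen P :=
        Finset.sum_le_sum fun d _ => hvArchSum_mono d h
    _ ≤ _ := Finset.sum_le_sum_of_subset_of_nonneg (offsetWindow_mono h)
        fun d _ _ => codedArchSum_nonneg d R

/-- **The Duminil-Copin–Smirnov bound on the total floor-arch mass**: for every `N`,
`Σ_{0 < |d| ≤ N+1} (coded arch mass of S_{N+1,N+1} at offset d) ≤ 1/cos(3π/8)` — read off at the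
root cell `x = 0` from `sum_floorArchMass_le`. [cite: DuminilCopinSmirnov2012, Lemma 2 and §3 ("A_T ≤ 1/c_α")] -/
theorem archTotal_le (N : ℕ) :
    ∑ d ∈ (Finset.Icc (-((N : ℤ) + 1)) ((N : ℤ) + 1)).erase 0,
      ∑ P ∈ (midWalks (stripV (N + 1) (N + 1))).filter
          (fun P => finalDart P = ((d, 0, false), (d, -1, true)) ∨
            finalDart P = ((d, -1, true), (d, 0, false))),
        hexCriticalFugacity ^ mwLen P ≤ (Real.cos (3 * Real.pi / 8))⁻¹ := by
  set x : Site 2 := 0 with hx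
  set Λ := (stripV (N + 1) (N + 1)).map
    (hvIso.trans (shift (-(x 0)) (-(x 1)))).symm.toEquiv.toEmbedding with hΛ
  set D := (Finset.Icc (-((N : ℤ) + 1)) ((N : ℤ) + 1)).erase 0 with hD
  -- rewrite every coded sum as a half-strip arch mass at the root cell `0`
  have hterm : ∀ d ∈ D, ∑ P ∈ (midWalks (stripV (N + 1) (N + 1))).filter
      (fun P => finalDart P = ((d, 0, false), (d, -1, true)) ∨
        finalDart P = ((d, -1, true), (d, 0, false))), hexCriticalFugacity ^ mwLen P =
      ∑ γ : HexMidEdgeSAW Λ s((x - Pi.single 1 1, 1), (x, 0))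
        s((x + Pi.single 0 d - Pi.single 1 1, 1), (x + Pi.single 0 d, 0)),
        hexCriticalFugacity ^ γ.length := by
    intro d hd
    rw [archMass_halfStrip_offset x N d (mem_offsetWindow_iff.1 hd).2]
  rw [Finset.sum_congr rfl hterm]
  -- reindex by the floor cells `y = x + d e₀`
  have hinj : Set.InjOn (fun d : ℤ => (x + Pi.single 0 d : Site 2)) (D : Set ℤ) :=
    (offsetCell_injective x).injOn
  rw [← Finset.sum_image (f := fun y : Site 2 => ∑ γ : HexMidEdgeSAW Λ
      s((x - Pi.single 1 1, 1), (x, 0)) s((y - Pi.single 1 1, 1), (y, 0)),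
      hexCriticalFugacity ^ γ.length) hinj]
  refine sum_floorArchMass_le Λ x (fun v hv => (halfStrip_geometry hv).1) _ fun y hy => ?_
  obtain ⟨d, hd, rfl⟩ := Finset.mem_image.1 hy
  exact ⟨offsetCell_apply_one x d, offsetCell_ne x (mem_offsetWindow_iff.1 hd).1⟩

/-- **The tail of the total arch series**: for every `ε > 0` there is `N₁` with
`archTotal N - archTotal N₁ ≤ ε` for all `N ≥ N₁` (a bounded monotone sequence is Cauchy).
[cite: DuminilCopinSmirnov2012, Lemma 2 and §3 ("A_T ≤ 1/c_α")] -/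
theorem exists_archTotal_tail (ε : ℝ) (hε : 0 < ε) :
    ∃ N₁ : ℕ, ∀ N : ℕ, N₁ ≤ N →
      (∑ d ∈ (Finset.Icc (-((N : ℤ) + 1)) ((N : ℤ) + 1)).erase 0,
        ∑ P ∈ (midWalks (stripV (N + 1) (N + 1))).filter
            (fun P => finalDart P = ((d, 0, false), (d, -1, true)) ∨
              finalDart P = ((d, -1, true), (d, 0, false))),
          hexCriticalFugacity ^ mwLen P) -
      (∑ d ∈ (Finset.Icc (-((N₁ : ℤ) + 1)) ((N₁ : ℤ) + 1)).erase 0,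
        ∑ P ∈ (midWalks (stripV (N₁ + 1) (N₁ + 1))).filter
            (fun P => finalDart P = ((d, 0, false), (d, -1, true)) ∨
              finalDart P = ((d, -1, true), (d, 0, false))),
          hexCriticalFugacity ^ mwLen P) ≤ ε := by
  set A : ℕ → ℝ := fun N => ∑ d ∈ (Finset.Icc (-((N : ℤ) + 1)) ((N : ℤ) + 1)).erase 0,
      ∑ P ∈ (midWalks (stripV (N + 1) (N + 1))).filter
          (fun P => finalDart P = ((d, 0, false), (d, -1, true)) ∨
            finalDart P = ((d, -1, true), (d, 0, false))),
        hexCriticalFugacity ^ mwLen P with hA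
  have hmono : Monotone A := archTotal_mono
  have hbdd : BddAbove (range A) :=
    ⟨(Real.cos (3 * Real.pi / 8))⁻¹, by rintro _ ⟨N, rfl⟩; exact archTotal_le N⟩
  have htend : Tendsto A atTop (𝓝 (⨆ N, A N)) := tendsto_atTop_ciSup hmono hbdd
  have hev : ∀ᶠ N in atTop, (⨆ N, A N) - ε < A N :=
    htend.eventually (lt_mem_nhds (sub_lt_self _ hε))
  obtain ⟨N₁, hN₁⟩ := eventually_atTop.1 hev
  refine ⟨N₁, fun N hN => ?_⟩
  show A N - A N₁ ≤ ε
  linarith [le_ciSup hbdd N, hN₁ N₁ le_rfl]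

/-! ### The summed far mass inside a half-strip -/

/-- **Summed far mass ≤ increment of the arch series.**  For `N₁ ≤ N` and a threshold
`R > 4N₁ + 4`, the far masses of the arches `s_x → t_{x + d e₀}` inside `S_x(N)`, summed over the
offset window of `S_x(N)`, are at most `archTotal N - archTotal N₁`: every walk of `S_x(N₁)` is near
(`halfStrip_geometry`, `archMass_le_nearArchMass`), and far + near = total
(`farArchMass_add_nearArchMass`). [cite: DuminilCopinSmirnov2012, Lemma 2 and §3] -/
theorem sum_farArchMass_halfStrip_le (x : Site 2) {N₁ N : ℕ} (hN : N₁ ≤ N) {R : ℝ}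
    (hR : 4 * (N₁ : ℝ) + 4 < R) :
    ∑ d ∈ (Finset.Icc (-((N : ℤ) + 1)) ((N : ℤ) + 1)).erase 0,
      (∑ γ : HexMidEdgeSAW ((stripV (N + 1) (N + 1)).map
          (hvIso.trans (shift (-(x 0)) (-(x 1)))).symm.toEquiv.toEmbedding)
          s((x - Pi.single 1 1, 1), (x, 0))
          s((x + Pi.single 0 d - Pi.single 1 1, 1), (x + Pi.single 0 d, 0)),
        if ∃ v ∈ γ.verts, R ≤ dist (hexCenter v) (hexMidpoint s((x - Pi.single 1 1, 1), (x, 0)))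
        then hexCriticalFugacity ^ γ.length else 0) ≤
      (∑ d ∈ (Finset.Icc (-((N : ℤ) + 1)) ((N : ℤ) + 1)).erase 0,
        ∑ P ∈ (midWalks (stripV (N + 1) (N + 1))).filter
            (fun P => finalDart P = ((d, 0, false), (d, -1, true)) ∨
              finalDart P = ((d, -1, true), (d, 0, false))),
          hexCriticalFugacity ^ mwLen P) -
      (∑ d ∈ (Finset.Icc (-((N₁ : ℤ) + 1)) ((N₁ : ℤ) + 1)).erase 0,
        ∑ P ∈ (midWalks (stripV (N₁ + 1) (N₁ + 1))).filter
            (fun P => finalDart P = ((d, 0, false), (d, -1, true)) ∨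
              finalDart P = ((d, -1, true), (d, 0, false))),
          hexCriticalFugacity ^ mwLen P) := by
  set s : Sym2 HexVertex := s((x - Pi.single 1 1, 1), (x, 0)) with hs
  set HSN := (stripV (N + 1) (N + 1)).map
    (hvIso.trans (shift (-(x 0)) (-(x 1)))).symm.toEquiv.toEmbedding with hHSN
  set HS1 := (stripV (N₁ + 1) (N₁ + 1)).map
    (hvIso.trans (shift (-(x 0)) (-(x 1)))).symm.toEquiv.toEmbedding with hHS1
  set DN := (Finset.Icc (-((N : ℤ) + 1)) ((N : ℤ) + 1)).erase 0 with hDN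
  set D1 := (Finset.Icc (-((N₁ : ℤ) + 1)) ((N₁ : ℤ) + 1)).erase 0 with hD1
  have hsub : HS1 ⊆ HSN := halfStrip_mono x hN
  have hnear : ∀ w ∈ HS1, dist (hexCenter w) (hexMidpoint s) < R := fun w hw =>
    lt_of_le_of_lt (halfStrip_geometry hw).2 hR
  -- termwise: far + (mass of the smaller strip) ≤ total
  have hterm : ∀ d ∈ DN,
      (∑ γ : HexMidEdgeSAW HSN s
          s((x + Pi.single 0 d - Pi.single 1 1, 1), (x + Pi.single 0 d, 0)),
        if ∃ v ∈ γ.verts, R ≤ dist (hexCenter v) (hexMidpoint s)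
        then hexCriticalFugacity ^ γ.length else 0) +
      (∑ γ : HexMidEdgeSAW HS1 s
          s((x + Pi.single 0 d - Pi.single 1 1, 1), (x + Pi.single 0 d, 0)),
        hexCriticalFugacity ^ γ.length) ≤
      ∑ P ∈ (midWalks (stripV (N + 1) (N + 1))).filter
          (fun P => finalDart P = ((d, 0, false), (d, -1, true)) ∨
            finalDart P = ((d, -1, true), (d, 0, false))),
        hexCriticalFugacity ^ mwLen P := by
    intro d hd
    rw [← archMass_halfStrip_offset x N d (mem_offsetWindow_iff.1 hd).2,
      ← farArchMass_add_nearArchMass HSN s _ R]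
    exact add_le_add le_rfl (archMass_le_nearArchMass hsub s _ R hnear)
  have hsum := Finset.sum_le_sum hterm
  rw [Finset.sum_add_distrib] at hsum
  -- the smaller strip's total over the larger window dominates `archTotal N₁`
  have hA1 : ∑ d ∈ D1, ∑ P ∈ (midWalks (stripV (N₁ + 1) (N₁ + 1))).filter
      (fun P => finalDart P = ((d, 0, false), (d, -1, true)) ∨
        finalDart P = ((d, -1, true), (d, 0, false))), hexCriticalFugacity ^ mwLen P ≤
      ∑ d ∈ DN, ∑ γ : HexMidEdgeSAW HS1 s
        s((x + Pi.single 0 d - Pi.single 1 1, 1), (x + Pi.single 0 d, 0)),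
        hexCriticalFugacity ^ γ.length := by
    have e : ∀ d ∈ D1, ∑ P ∈ (midWalks (stripV (N₁ + 1) (N₁ + 1))).filter
        (fun P => finalDart P = ((d, 0, false), (d, -1, true)) ∨
          finalDart P = ((d, -1, true), (d, 0, false))), hexCriticalFugacity ^ mwLen P =
        ∑ γ : HexMidEdgeSAW HS1 s
          s((x + Pi.single 0 d - Pi.single 1 1, 1), (x + Pi.single 0 d, 0)),
          hexCriticalFugacity ^ γ.length := fun d hd =>
      (archMass_halfStrip_offset x N₁ d (mem_offsetWindow_iff.1 hd).2).symm
    rw [Finset.sum_congr rfl e]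
    exact Finset.sum_le_sum_of_subset_of_nonneg (offsetWindow_mono hN)
      fun d _ _ => archMass_nonneg _ _ _
  linarith

/-! ### The theorem -/

/-- **ENDPOINT-SUMMED HALF-PLANE ARCH TIGHTNESS (absolute tail of the critical arch series,
uniform in the domain and in the root).**  For every `ε > 0` there is ONE threshold `R₀` such that
for every cell `x`, every finite vertex set `Λ` in the rows `≥ x₁` (a finite piece of the closed
upper half-lattice whose floor mid-edges are `t_y = {(y - e₁, 1), (y, 0)}`, `y₁ = x₁`), every finite
set `S` of non-zero offsets and every `R ≥ R₀`, the `x_c`-masses of the self-avoiding walks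
`s_x → t_{x + d e₀}` in `Λ` having a vertex at distance `≥ R` from `mid s_x`, summed over `d ∈ S`,
total at most `ε`.  This is the half of the registered open stub `stub_halfPlaneArchTightness` that
follows from Duminil-Copin–Smirnov arch finiteness; the stub itself asks for the far mass of ONE
endpoint `t` at span `n` to be small RELATIVE to `Z_{B(2Kn)}(s, t)`, uniformly in `n` (open).
[cite: DuminilCopinSmirnov2012, Lemma 2 and §3 ("A_{T,L} ≤ 1/c_α"); LawlerSchrammWerner2004SAW, §3.4 ("SAW satisfies restriction")] -/
theorem farArchMass_offsetSum_le (ε : ℝ) (hε : 0 < ε) :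
    ∃ R₀ : ℝ, 0 < R₀ ∧ ∀ (x : Site 2) (Λ : Finset HexVertex), (∀ v ∈ Λ, x 1 ≤ v.1 1) →
      ∀ (S : Finset ℤ), 0 ∉ S → ∀ R : ℝ, R₀ ≤ R →
      ∑ d ∈ S, (∑ γ : HexMidEdgeSAW Λ s((x - Pi.single 1 1, 1), (x, 0))
          s((x + Pi.single 0 d - Pi.single 1 1, 1), (x + Pi.single 0 d, 0)),
        if ∃ v ∈ γ.verts, R ≤ dist (hexCenter v) (hexMidpoint s((x - Pi.single 1 1, 1), (x, 0)))
        then hexCriticalFugacity ^ γ.length else 0) ≤ ε := by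
  obtain ⟨N₁, hN₁⟩ := exists_archTotal_tail ε hε
  refine ⟨4 * N₁ + 5, by positivity, fun x Λ hΛ S hS R hR => ?_⟩
  -- a half-strip containing `Λ` whose offset window contains `S`
  set N₀ : ℕ := N₁ + ∑ d ∈ S, (|d|).toNat with hN₀
  obtain ⟨N, hN₀N, hΛN⟩ := exists_subset_halfStrip Λ x hΛ N₀
  have hN₁N : N₁ ≤ N := le_trans (Nat.le_add_right _ _) hN₀N
  set HSN := (stripV (N + 1) (N + 1)).map
    (hvIso.trans (shift (-(x 0)) (-(x 1)))).symm.toEquiv.toEmbedding with hHSN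
  set DN := (Finset.Icc (-((N : ℤ) + 1)) ((N : ℤ) + 1)).erase 0 with hDN
  have hSD : S ⊆ DN := by
    intro d hd
    rw [hDN, mem_offsetWindow_iff]
    refine ⟨fun h => hS (h ▸ hd), ?_⟩
    have h1 : (|d|).toNat ≤ ∑ d' ∈ S, (|d'|).toNat :=
      Finset.single_le_sum (f := fun d' : ℤ => (|d'|).toNat) (fun _ _ => Nat.zero_le _) hd
    have h2 : (|d| : ℤ) = ((|d|).toNat : ℤ) := (Int.toNat_of_nonneg (abs_nonneg d)).symm
    have h3 : ((|d|).toNat : ℤ) ≤ N := by exact_mod_cast h1.trans ((Nat.le_add_left _ _).trans hN₀N)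
    omega
  have hR' : 4 * (N₁ : ℝ) + 4 < R := lt_of_lt_of_le (by linarith) hR
  set s : Sym2 HexVertex := s((x - Pi.single 1 1, 1), (x, 0)) with hs
  calc ∑ d ∈ S, (∑ γ : HexMidEdgeSAW Λ s
          s((x + Pi.single 0 d - Pi.single 1 1, 1), (x + Pi.single 0 d, 0)),
          if ∃ v ∈ γ.verts, R ≤ dist (hexCenter v) (hexMidpoint s)
          then hexCriticalFugacity ^ γ.length else 0)
      ≤ ∑ d ∈ S, (∑ γ : HexMidEdgeSAW HSN s
          s((x + Pi.single 0 d - Pi.single 1 1, 1), (x + Pi.single 0 d, 0)),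
          if ∃ v ∈ γ.verts, R ≤ dist (hexCenter v) (hexMidpoint s)
          then hexCriticalFugacity ^ γ.length else 0) :=
        Finset.sum_le_sum fun d _ => farArchMass_mono hΛN s _ R
    _ ≤ ∑ d ∈ DN, (∑ γ : HexMidEdgeSAW HSN s
          s((x + Pi.single 0 d - Pi.single 1 1, 1), (x + Pi.single 0 d, 0)),
          if ∃ v ∈ γ.verts, R ≤ dist (hexCenter v) (hexMidpoint s)
          then hexCriticalFugacity ^ γ.length else 0) := by
        refine Finset.sum_le_sum_of_subset_of_nonneg hSD fun d _ _ => ?_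
        refine Finset.sum_nonneg fun γ _ => ?_
        split_ifs
        · exact pow_nonneg hexCriticalFugacity_pos_lt_one.1.le _
        · exact le_rfl
    _ ≤ _ := sum_farArchMass_halfStrip_le x hN₁N hR'
    _ ≤ ε := hN₁ N hN₁N

/-- **Registered sub-goal `stub_archTailSummed`** (crux item stmt-CriticalPhenomena-0808, line
`root-locality-replaces-loewner`; the theorem half of `stub_halfPlaneArchTightness`): the
endpoint-summed far mass of the critical half-plane arches tends to `0` with the threshold,
uniformly in the domain above the floor and in the root cell (`farArchMass_offsetSum_le`).
[cite: DuminilCopinSmirnov2012, Lemma 2 and §3 ("A_{T,L} ≤ 1/c_α")] -/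
theorem stub_archTailSummed : ∀ ε : ℝ, 0 < ε → ∃ R₀ : ℝ, 0 < R₀ ∧
    ∀ (x : Literature.Probability.LatticeModels.Site 2)
      (Λ : Finset Literature.Probability.LatticeModels.HexVertex), (∀ v ∈ Λ, x 1 ≤ v.1 1) →
      ∀ (S : Finset ℤ), 0 ∉ S → ∀ R : ℝ, R₀ ≤ R →
      ∑ d ∈ S, (∑ γ : Literature.Probability.RandomPlanarGeometry.SAW.HexMidEdgeSAW Λ
          s((x - Pi.single 1 1, 1), (x, 0))
          s((x + Pi.single 0 d - Pi.single 1 1, 1), (x + Pi.single 0 d, 0)),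
        if ∃ v ∈ γ.verts, R ≤ dist (Literature.Probability.LatticeModels.hexCenter v)
            (Literature.Probability.RandomPlanarGeometry.SAW.hexMidpoint
              s((x - Pi.single 1 1, 1), (x, 0)))
        then Literature.Probability.RandomPlanarGeometry.SAW.hexCriticalFugacity ^ γ.length
        else 0) ≤ ε :=
  farArchMass_offsetSum_le

end Summit.CriticalPhenomena.SAWScalingLimit.Theorems.HexConjecture.RootLocality

end
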